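import Mathlib
import Summits.CriticalPhenomena.PercolationContinuityZ3.Theorems.PercNearOneGluingNoHeavyLowerTailBoundaryGluing
import Summits.CriticalPhenomena.PercolationContinuityZ3.Theorems.PercNearOneGluingNoHeavyLowerTailPocketMomentsMeanConnection
import HarnessLib

/-!
# `NoHeavyLowerTail` (stmt-CriticalPhenomena-4575) — the AVERAGED blob gluing bound (the selection term with
# deterministic per-cluster reference graphs) and the lower-tail form of internal-edge gluing

Support file (depth prover `nh-dp-blobmono`, respawn g5; `--supports stmt-CriticalPhenomena-4575`).  Sequel to
`…BoundaryGluing.lean` / `…InternalEdgeGluing.lean`.  No definitions, no sorries.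

`μ = prodBernoulli w` on `Fin n`, relays `A ∋ b`, closed region `R ∋ o` disjoint from `A`, blob events
`Blob(V₀)` = "the open relay-free cluster of `o` has vertex set `V₀`" (lf-6, `…SteinerBlobMeasure`), `G − ∂V₀` = pairs
from `V₀` to non-relays outside `V₀` deleted.

* `blobAveragedGluing` — for ANY per-cluster slacks `θ(V₀) ≥ μ_{G−∂V₀}(a ↮ b)` (`a ∈ A`, `o ∈ V₀ ⊆ R`):
  **`μ(o ↔ A) − μ(o ↔ b) ≤ Σ_{V₀ ∋ o, V₀ ∩ A = ∅} μ(Blob V₀) · θ(V₀)`** (blobs leaving `R` contribute `0`).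
  This is the exact frontier of the method in Conjecture-3 form: the right-hand side is the SELECTION TERM
  `E_W[max_a μ_{G−∂W}(a ↮ b)]` of the lead's (SEL) / lf-6's port selection, with the observer's ports kept; the
  uniform case `θ ≡ const` is `boundaryGluing`, and `θ(V₀) := max_a μ_{G−E(R)}(a ↮ b)` is `internalEdgeGluing`.
* `internalEdge_lowerTail` — the crux's conclusion on the internal-edge class: if every relay pair is
  `t`-reliable after deleting the pairs inside `R` (`μ_{G−E(R)}(a ↮ a') ≤ t`), then
  `(E N − θ)·μ(1 ≤ N ≤ θ) ≤ E N · t` for every `θ` (LINEAR, via `PocketMoments.lowerTail_mul_le_eventGluing`).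
-/

namespace Summit.CriticalPhenomena.PercolationContinuityZ3.Theorems

open MeasureTheory Set
open Literature.Probability.LatticeModels (prodBernoulli)
open Literature.Probability.Percolation (BondConfig openConn openConnIn openGraph)

noncomputable section
open Classical

variable {n : ℕ}

/-- **Averaged blob gluing.**  Closed region `R ∋ o` disjoint from `A ∋ b`, and per-cluster slacks `θ` with
`μ_{G−∂V₀}(a ↮ b) ≤ θ V₀` for all `a ∈ A` and all `V₀` with `o ∈ V₀ ⊆ R`.  Then
`μ(o ↔ A) − μ(o ↔ b) ≤ Σ_{V₀ ∋ o, V₀ disjoint from A} μ(Blob V₀)·θ V₀`. [this work; cite: KozmaNitzan2024, Thm. 4 (p. 12)] -/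
theorem blobAveragedGluing (w : Sym2 (Fin n) → unitInterval) (R A : Finset (Fin n)) (o b : Fin n)
    (θ : Finset (Fin n) → ℝ)
    (hbA : b ∈ A) (hoR : o ∈ R) (hRA : Disjoint R A)
    (hcl : ∀ x ∈ R, ∀ y : Fin n, y ∉ R → y ∉ A → w s(x, y) = 0)
    (hrel : ∀ V₀ : Finset (Fin n), o ∈ V₀ → V₀ ⊆ R → ∀ a ∈ A, (prodBernoulli (fun e : Sym2 (Fin n) =>
      if ((∃ u ∈ e, u ∈ V₀) ∧ ∃ v ∈ e, v ∉ V₀ ∧ v ∉ A) then 0 else w e)).real (openConn a b)ᶜ ≤ θ V₀) :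
    (prodBernoulli w).real (⋃ a ∈ A, (openConn o a : Set (BondConfig (Fin n)))) -
      (prodBernoulli w).real (openConn o b) ≤
      ∑ V₀ ∈ (Finset.univ : Finset (Finset (Fin n))).filter (fun V₀ => o ∈ V₀ ∧ Disjoint V₀ A),
        (prodBernoulli w).real {ω : BondConfig (Fin n) | (∀ u ∈ V₀, ω ∈ openConnIn (↑V₀ : Set (Fin n)) o u) ∧
          ∀ u ∈ V₀, ∀ x, x ∉ V₀ → x ∉ A → s(u, x) ∉ ω} * θ V₀ := by
  set μ := prodBernoulli w with hμ
  have hoA : o ∉ A := fun h => Finset.disjoint_left.1 hRA hoR h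
  set EA : Set (BondConfig (Fin n)) := ⋃ a ∈ A, (openConn o a : Set (BondConfig (Fin n))) with hEA
  set Eb : Set (BondConfig (Fin n)) := openConn o b with hEb
  set 𝒱 : Finset (Finset (Fin n)) :=
    (Finset.univ : Finset (Finset (Fin n))).filter (fun V₀ => o ∈ V₀ ∧ Disjoint V₀ A) with h𝒱
  set Bl : Finset (Fin n) → Set (BondConfig (Fin n)) := fun V₀ =>
    {ω : BondConfig (Fin n) | (∀ u ∈ V₀, ω ∈ openConnIn (↑V₀ : Set (Fin n)) o u) ∧
      ∀ u ∈ V₀, ∀ x, x ∉ V₀ → x ∉ A → s(u, x) ∉ ω} with hBl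
  have hsumA : ∑ V₀ ∈ 𝒱, μ.real (EA ∩ Bl V₀) = μ.real EA := SteinerBlob.sum_measureReal_inter_blob w A o hoA EA
  have hsumb : ∑ V₀ ∈ 𝒱, μ.real (Eb ∩ Bl V₀) = μ.real Eb := SteinerBlob.sum_measureReal_inter_blob w A o hoA Eb
  have hterm : ∀ V₀ ∈ 𝒱, μ.real (EA ∩ Bl V₀) - μ.real (Eb ∩ Bl V₀) ≤ μ.real (Bl V₀) * θ V₀ := by
    intro V₀ hV₀
    obtain ⟨ho, hVA⟩ := (Finset.mem_filter.1 hV₀).2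
    by_cases hVR : V₀ ⊆ R
    · set Ψ : BondConfig (Fin n) → BondConfig (Fin n) := fun ω =>
        ({e : Sym2 (Fin n) | (e ∈ ω ∧ ∀ v ∈ e, v ∉ V₀) ∨
          ∃ a ∈ A, e = s(o, a) ∧ ∃ u ∈ V₀, s(u, a) ∈ ω} : BondConfig (Fin n)) with hΨ
      set wt : Sym2 (Fin n) → unitInterval := fun e => (⟨μ.real {ω : BondConfig (Fin n) | e ∈ Ψ ω},
        ⟨measureReal_nonneg, measureReal_le_one⟩⟩ : unitInterval) with hwt
      have hreach : ∀ ω ∈ Bl V₀, ∀ a ∈ A, ((openGraph ω).Reachable o a ↔ (openGraph (Ψ ω)).Reachable o a) := by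
        intro ω hω a ha
        have haV : a ∉ V₀ := fun h => Finset.disjoint_left.1 hVA h ha
        exact SteinerBlob.reachable_contract_iff ho hVA hω (Or.inl rfl) (Or.inr haV)
      have hEA' : EA ∩ Bl V₀ = Bl V₀ ∩ Ψ ⁻¹' EA := by
        ext ω
        simp only [hEA, Set.mem_inter_iff, Set.mem_preimage, Set.mem_iUnion, exists_prop]
        constructor
        · rintro ⟨⟨a, ha, h⟩, hω⟩
          exact ⟨hω, a, ha, (hreach ω hω a ha).1 h⟩
        · rintro ⟨hω, a, ha, h⟩
          exact ⟨⟨a, ha, (hreach ω hω a ha).2 h⟩, hω⟩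
      have hEb' : Eb ∩ Bl V₀ = Bl V₀ ∩ Ψ ⁻¹' Eb := by
        ext ω
        simp only [hEb, Set.mem_inter_iff, Set.mem_preimage]
        constructor
        · rintro ⟨h, hω⟩
          exact ⟨hω, (hreach ω hω b hbA).1 h⟩
        · rintro ⟨hω, h⟩
          exact ⟨(hreach ω hω b hbA).2 h, hω⟩
      have hfacA : μ.real (EA ∩ Bl V₀) = μ.real (Bl V₀) * (prodBernoulli wt).real EA := by
        rw [hEA', SteinerBlob.measureReal_blob_inter_preimage_contract w hVA EA,
          SteinerBlob.measureReal_preimage_contract w hVA EA]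
      have hfacb : μ.real (Eb ∩ Bl V₀) = μ.real (Bl V₀) * (prodBernoulli wt).real Eb := by
        rw [hEb', SteinerBlob.measureReal_blob_inter_preimage_contract w hVA Eb,
          SteinerBlob.measureReal_preimage_contract w hVA Eb]
      have hOA : Disjoint ({o} : Finset (Fin n)) A := Finset.disjoint_singleton_left.2 hoA
      have hiso : ∀ x ∈ ({o} : Finset (Fin n)), ∀ y : Fin n, y ∉ ({o} : Finset (Fin n)) → y ∉ A →
          wt s(x, y) = 0 := by
        intro x hx y hyo hyA
        rw [Finset.mem_singleton] at hx hyo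
        subst hx
        exact SteinerBlob.blobWeight_eq_zero w ho hyo hyA
      have hrel' : ∀ a ∈ A, (prodBernoulli (fun e : Sym2 (Fin n) =>
          if (∀ x ∈ e, x ∈ ({o} : Finset (Fin n))) ∧ ¬ e.IsDiag then 1 else wt e)).real (openConn a b)ᶜ ≤ θ V₀ := by
        intro a ha
        rw [agPartial_glue_singleton]
        exact le_trans (InternalEdge.blobWeight_compl_le_killBoundary w ho hVA ha hbA) (hrel V₀ ho hVR a ha)
      have hbase := pocketGlue_base wt {o} A b (θ V₀) hbA hOA hiso hrel'
      rw [agPartial_glue_singleton, Finset.set_biUnion_singleton, Finset.set_biUnion_singleton] at hbase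
      rw [hfacA, hfacb]
      have hBl0 : 0 ≤ μ.real (Bl V₀) := measureReal_nonneg
      nlinarith [hbase, hBl0]
    · have h0 : μ.real (Bl V₀) = 0 := InternalEdge.blob_null w hoR hVA hcl hVR
      have h1 : μ.real (EA ∩ Bl V₀) ≤ μ.real (Bl V₀) :=
        measureReal_mono Set.inter_subset_right (measure_ne_top μ _)
      have h2 : 0 ≤ μ.real (Eb ∩ Bl V₀) := measureReal_nonneg
      rw [h0] at h1 ⊢
      linarith
  rw [← hsumA, ← hsumb, ← Finset.sum_sub_distrib]
  exact Finset.sum_le_sum hterm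

/-- **Lower tail on the internal-edge class (linear).**  Closed region `R ∋ o` disjoint from `A`; if every relay
pair is `t`-reliable after deleting the pairs inside `R` then `(E N − θ) · μ(1 ≤ N ≤ θ) ≤ E N · t` for every `θ`.
[this work; cite: KozmaNitzan2024, Conjecture 3 (p. 15)] -/
theorem internalEdge_lowerTail (w : Sym2 (Fin n) → unitInterval) (R A : Finset (Fin n)) (o : Fin n) (t θ : ℝ)
    (hoR : o ∈ R) (hRA : Disjoint R A)
    (hcl : ∀ x ∈ R, ∀ y : Fin n, y ∉ R → y ∉ A → w s(x, y) = 0)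
    (hrel : ∀ a ∈ A, ∀ a' ∈ A, (prodBernoulli (fun e : Sym2 (Fin n) =>
      if (∀ x ∈ e, x ∈ R) then 0 else w e)).real (openConn a a')ᶜ ≤ t) :
    ((∑ a ∈ A, (prodBernoulli w).real (openConn o a : Set (BondConfig (Fin n)))) - θ) *
        (prodBernoulli w).real {ω : BondConfig (Fin n) |
          1 ≤ (A.filter fun a => ω ∈ openConn o a).card ∧ ((A.filter fun a => ω ∈ openConn o a).card : ℝ) ≤ θ} ≤
      (∑ a ∈ A, (prodBernoulli w).real (openConn o a : Set (BondConfig (Fin n)))) * t := by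
  refine PocketMoments.lowerTail_mul_le_eventGluing w A o θ t fun a' ha' => ?_
  have hglue := internalEdgeGluing w R A o a' t ha' hoR hRA hcl fun a ha => hrel a ha a' ha'
  have hsub : (openConn o a' : Set (BondConfig (Fin n))) ⊆ ⋃ a ∈ A, (openConn o a : Set (BondConfig (Fin n))) :=
    fun ω hω => Set.mem_iUnion₂.2 ⟨a', ha', hω⟩
  have hdiff : (prodBernoulli w).real ((⋃ a ∈ A, (openConn o a : Set (BondConfig (Fin n)))) ∩ (openConn o a')ᶜ) =
      (prodBernoulli w).real (⋃ a ∈ A, (openConn o a : Set (BondConfig (Fin n)))) -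
        (prodBernoulli w).real (openConn o a') := by
    rw [← Set.sdiff_eq]
    exact measureReal_sdiff hsub (pocketGlue_measurableSet _) (measure_ne_top _ _)
  rw [hdiff]
  exact hglue

end

end Summit.CriticalPhenomena.PercolationContinuityZ3.Theorems
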